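import Summits.MatrixMultiplication.MatrixMultiplication.Theorems.FarEdgeDescentTreeCapTools

/-!
# Far-edge descent, kernel XLI-E — tools for the LIGHT-base tree cap: the vertex reduction under a reachability envelope, mirrored/boxed pair bounds, a denser tangent table (model level)

Kernel XLI-A…D cap every floor-respecting product tree of the `β = 3/2` dial whose bases are HEAVY
(`b ≥ 1/2`, share `μ ≤ 1/2`).  Light bases (`0 ≤ b < 1/2`, shares up to `1/β = 2/3`) violate the pair
criterion on the plain box, but only at UNREACHABLE states: every admissible tree obeys the
reachability ENVELOPE `w ≤ 3(2/3 − λ)` (kernel XLI-F), i.e. its potential `Φ = w + ελ` lies below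
`U(λ) = min(Mλ, 2 − (3−ε)λ)`.  This file generalises the vertex reduction of XLI-B to such envelopes:
* `criterion_of_vertex_env`: factors constrained by an arbitrary cap `Φ ≤ U(λ)` with `U(λ) ≤ (1+ε)λ`,
  the product by an arbitrary cap `Φ_P ≤ W(λ_P)`, shares in the LIGHT window `βλ ≤ 1` (so `1 − βλ`
  may vanish).  The criterion follows from TWO vertex families: `P1 = (U(λ), (W(λ_P) − C − (1−βλ')U(λ))/(1−βλ))`
  (needed only where the corner `(U(λ), U(λ'))` violates the product cap and the cap is nonnegative)
  and the CORNER itself (needed only where it satisfies the product cap); the degenerate shares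
  `βλ = βλ' = 1` fall under the corner case automatically.
* `pair_box`, `pair_unbalanced_mirror`: crude / mirrored companions of `pair_unbalanced`;
* `eighth_rpow_kappaS` (`(1/8)^{κ_S} = 27/64`) and certified tangent heights `ρ ≥ x₀^{κ_S}` at
  `x₀ ∈ {9/10, 4/5, 3/5, 9/20, 3/8, 3/10}` (`rho_p9`, …, `rho_p3`, each by `x₀^17 ≤ ρ^41`).
HONEST FRAMING: MODEL level, elementary; no `sorry`, no axioms, no definitions.
References: kernels XLI-A…D (memo NODE-g61), Schönhage 1981 [Schonhage1981].
-/

noncomputable section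

set_option linter.dupNamespace false

namespace Summit.MatrixMultiplication.MatrixMultiplication.Theorems.FarEdgeDescentTreeCapEnvTools

open Summit.MatrixMultiplication.MatrixMultiplication.Theorems.FarEdgeDescentChainCapSteps
open Summit.MatrixMultiplication.MatrixMultiplication.Theorems.FarEdgeDescentTreeCapTools

/-! ## Small pair bounds and tangent heights -/

/-- `(1/8)^{κ_S} = 27/64`. -/
theorem eighth_rpow_kappaS : (1 / 8 : ℝ) ^ (Real.log (4 / 3) / Real.log 2) = 27 / 64 := by
  have h : (1 / 8 : ℝ) = (1 / 2) ^ (3:ℝ) := by norm_num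
  rw [h, ← Real.rpow_mul (by norm_num), mul_comm, Real.rpow_mul (by norm_num), half_rpow_kappaS]
  norm_num

/-- Tangent height at `x₀ = 1/8`: `(1/8)^{κ_S} ≤ 27/64` (exact). -/
theorem rho_eighth : (1 / 8 : ℝ) ^ (Real.log (4 / 3) / Real.log 2) ≤ 27 / 64 := eighth_rpow_kappaS.le

/-- Tangent height at `x₀ = 9/10`: `(9/10)^{κ_S} ≤ 0.9573`. -/
theorem rho_p9 : (9 / 10 : ℝ) ^ (Real.log (4 / 3) / Real.log 2) ≤ 9573 / 10000 :=
  rpow_kappaS_le_of_pow (by norm_num) (by norm_num) (by norm_num) (by norm_num)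

/-- Tangent height at `x₀ = 4/5`: `(4/5)^{κ_S} ≤ 0.9117`. -/
theorem rho_p8 : (4 / 5 : ℝ) ^ (Real.log (4 / 3) / Real.log 2) ≤ 9117 / 10000 :=
  rpow_kappaS_le_of_pow (by norm_num) (by norm_num) (by norm_num) (by norm_num)

/-- Tangent height at `x₀ = 3/5`: `(3/5)^{κ_S} ≤ 0.8092`. -/
theorem rho_p6 : (3 / 5 : ℝ) ^ (Real.log (4 / 3) / Real.log 2) ≤ 8092 / 10000 :=
  rpow_kappaS_le_of_pow (by norm_num) (by norm_num) (by norm_num) (by norm_num)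

/-- Tangent height at `x₀ = 9/20`: `(9/20)^{κ_S} ≤ 0.7182`. -/
theorem rho_p45 : (9 / 20 : ℝ) ^ (Real.log (4 / 3) / Real.log 2) ≤ 7182 / 10000 :=
  rpow_kappaS_le_of_pow (by norm_num) (by norm_num) (by norm_num) (by norm_num)

/-- Tangent height at `x₀ = 3/8`: `(3/8)^{κ_S} ≤ 0.666`. -/
theorem rho_q : (3 / 8 : ℝ) ^ (Real.log (4 / 3) / Real.log 2) ≤ 333 / 500 :=
  rpow_kappaS_le_of_pow (by norm_num) (by norm_num) (by norm_num) (by norm_num)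

/-- Tangent height at `x₀ = 3/10`: `(3/10)^{κ_S} ≤ 0.6071`. -/
theorem rho_p3 : (3 / 10 : ℝ) ^ (Real.log (4 / 3) / Real.log 2) ≤ 6071 / 10000 :=
  rpow_kappaS_le_of_pow (by norm_num) (by norm_num) (by norm_num) (by norm_num)

/-- **Box bound.**  `a ≥ 0 ⟹ a·x^{κ_S} + b·(1−x)^{κ_S} ≤ a + max b 0` on `[0,1]`. -/
theorem pair_box {a b x : ℝ} (ha : 0 ≤ a) (hx0 : 0 ≤ x) (hx1 : x ≤ 1) :
    a * x ^ (Real.log (4 / 3) / Real.log 2) + b * (1 - x) ^ (Real.log (4 / 3) / Real.log 2) ≤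
      a + max b 0 := by
  set k := Real.log (4 / 3) / Real.log 2
  have hX0 : 0 ≤ x ^ k := Real.rpow_nonneg hx0 k
  have hX1 : x ^ k ≤ 1 := Real.rpow_le_one hx0 hx1 kappaS_nonneg
  have hY0 : 0 ≤ (1 - x) ^ k := Real.rpow_nonneg (by linarith) k
  have hY1 : (1 - x) ^ k ≤ 1 := Real.rpow_le_one (by linarith) (by linarith) kappaS_nonneg
  have h1 : a * x ^ k ≤ a := mul_le_of_le_one_right ha hX1
  have h2 : b * (1 - x) ^ k ≤ max b 0 := by
    rcases le_or_gt 0 b with hb | hb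
    · exact (mul_le_of_le_one_right hb hY1).trans (le_max_left _ _)
    · exact (mul_nonpos_of_nonpos_of_nonneg hb.le hY0).trans (le_max_right _ _)
  linarith

/-- **Mirrored box bound.**  `b ≥ 0 ⟹ a·x^{κ_S} + b·(1−x)^{κ_S} ≤ max a 0 + b` on `[0,1]`. -/
theorem pair_box_mirror {a b x : ℝ} (hb : 0 ≤ b) (hx0 : 0 ≤ x) (hx1 : x ≤ 1) :
    a * x ^ (Real.log (4 / 3) / Real.log 2) + b * (1 - x) ^ (Real.log (4 / 3) / Real.log 2) ≤
      max a 0 + b := by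
  have h := pair_box (a := b) (b := a) hb (x := 1 - x) (by linarith) (by linarith)
  have e : 1 - (1 - x) = x := by ring
  rw [e] at h
  linarith

/-- **Mirrored unbalanced pairs.**  If `(9/4)·a ≤ b` (`a ≥ 0`) then
`a·x^{κ_S} + b·(1−x)^{κ_S} ≤ b + (1−κ_S)(9/16)·a`. -/
theorem pair_unbalanced_mirror {a b x : ℝ} (ha : 0 ≤ a) (hab : 9 / 4 * a ≤ b) (hx0 : 0 ≤ x)
    (hx1 : x ≤ 1) :
    a * x ^ (Real.log (4 / 3) / Real.log 2) + b * (1 - x) ^ (Real.log (4 / 3) / Real.log 2) ≤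
      b + (1 - Real.log (4 / 3) / Real.log 2) * (9 / 16) * a := by
  have h := pair_unbalanced (a := b) (b := a) ha hab (x := 1 - x) (by linarith) (by linarith)
  have e : 1 - (1 - x) = x := by ring
  rw [e] at h
  linarith

/-! ## The vertex reduction under an envelope -/

/-- **Vertex reduction under an envelope.**  Let `0 ≤ ε` (any real `β`), and let `U, W : ℝ → ℝ` be caps
with `U(λ) ≤ (1+ε)λ` on the light window `0 < λ`, `βλ ≤ 1`.  Write `q = 1−βλ`, `n = 1−(β−1)λ`,
`λ_P = λ+λ'−(2β−1)λλ'`, `C = (1+ε)λλ'`, `X = x^{κ_S}`, `Y = (1−x)^{κ_S}`.  Suppose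
(P1) whenever `0 ≤ W(λ_P) − C < q'U(λ) + qU(λ')`:
     `q·n'·U(λ)·X + n·(W(λ_P) − C − q'U(λ))·Y ≤ q·W(λ_P)`, and
(Corner) whenever `q'U(λ) + qU(λ') ≤ W(λ_P) − C`:
     `n'·U(λ)·X + n·U(λ')·Y ≤ q'U(λ) + qU(λ') + C`.
Then the pair criterion holds on the polytope `0 ≤ Φ ≤ U(λ)`, `0 ≤ Φ' ≤ U(λ')`,
`q'Φ + qΦ' + C ≤ W(λ_P)`: `n'ΦX + nΦ'Y ≤ q'Φ + qΦ' + C`. -/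
theorem criterion_of_vertex_env {β ε : ℝ} {U W : ℝ → ℝ} (hε : 0 ≤ ε)
    (hU : ∀ l : ℝ, 0 < l → β * l ≤ 1 → U l ≤ (1 + ε) * l)
    (hP1 : ∀ lA lB x : ℝ, 0 < lA → β * lA ≤ 1 → 0 < lB → β * lB ≤ 1 → 0 ≤ x → x ≤ 1 →
      0 ≤ W (lA + lB - (2 * β - 1) * lA * lB) - (1 + ε) * lA * lB →
      W (lA + lB - (2 * β - 1) * lA * lB) - (1 + ε) * lA * lB <
        (1 - β * lB) * U lA + (1 - β * lA) * U lB →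
      (1 - β * lA) * (1 - (β - 1) * lB) * U lA * x ^ (Real.log (4 / 3) / Real.log 2) +
          (1 - (β - 1) * lA) * (W (lA + lB - (2 * β - 1) * lA * lB) - (1 + ε) * lA * lB -
            (1 - β * lB) * U lA) * (1 - x) ^ (Real.log (4 / 3) / Real.log 2) ≤
        (1 - β * lA) * W (lA + lB - (2 * β - 1) * lA * lB))
    (hC : ∀ lA lB x : ℝ, 0 < lA → β * lA ≤ 1 → 0 < lB → β * lB ≤ 1 → 0 ≤ x → x ≤ 1 →
      (1 - β * lB) * U lA + (1 - β * lA) * U lB ≤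
        W (lA + lB - (2 * β - 1) * lA * lB) - (1 + ε) * lA * lB →
      (1 - (β - 1) * lB) * U lA * x ^ (Real.log (4 / 3) / Real.log 2) +
          (1 - (β - 1) * lA) * U lB * (1 - x) ^ (Real.log (4 / 3) / Real.log 2) ≤
        (1 - β * lB) * U lA + (1 - β * lA) * U lB + (1 + ε) * lA * lB) :
    ∀ lA lB PA PB x : ℝ, 0 < lA → β * lA ≤ 1 → 0 < lB → β * lB ≤ 1 →
      0 ≤ PA → PA ≤ U lA → 0 ≤ PB → PB ≤ U lB →
      (1 - β * lB) * PA + (1 - β * lA) * PB + (1 + ε) * lA * lB ≤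
        W (lA + lB - (2 * β - 1) * lA * lB) →
      0 ≤ x → x ≤ 1 →
      (1 - (β - 1) * lB) * PA * x ^ (Real.log (4 / 3) / Real.log 2) +
          (1 - (β - 1) * lA) * PB * (1 - x) ^ (Real.log (4 / 3) / Real.log 2) ≤
        (1 - β * lB) * PA + (1 - β * lA) * PB + (1 + ε) * lA * lB := by
  intro lA lB PA PB x hlA0 hlA1 hlB0 hlB1 hPA0 hPA1 hPB0 hPB1 hline hx0 hx1
  set k := Real.log (4 / 3) / Real.log 2 with hk
  set X := x ^ k with hX
  set Y := (1 - x) ^ k with hY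
  have hX0 : 0 ≤ X := Real.rpow_nonneg hx0 k
  have hX1 : X ≤ 1 := Real.rpow_le_one hx0 hx1 kappaS_nonneg
  have hY0 : 0 ≤ Y := Real.rpow_nonneg (by linarith) k
  have hY1 : Y ≤ 1 := Real.rpow_le_one (by linarith) (by linarith) kappaS_nonneg
  set UA := U lA with hUA
  set UB := U lB with hUB
  set WP := W (lA + lB - (2 * β - 1) * lA * lB) with hWP
  have hUA1 : UA ≤ (1 + ε) * lA := hU lA hlA0 hlA1
  have hUB1 : UB ≤ (1 + ε) * lB := hU lB hlB0 hlB1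
  -- shares, dampings (light window: q ≥ 0 only)
  have hqA : 0 ≤ 1 - β * lA := by linarith
  have hqB : 0 ≤ 1 - β * lB := by linarith
  have hnA : 0 ≤ 1 - (β - 1) * lA := by linarith
  have hnB : 0 ≤ 1 - (β - 1) * lB := by linarith
  set qA := 1 - β * lA with hqAdef
  set qB := 1 - β * lB with hqBdef
  set nA := 1 - (β - 1) * lA with hnAdef
  set nB := 1 - (β - 1) * lB with hnBdef
  set C := (1 + ε) * lA * lB with hCdef
  have hC0 : 0 ≤ C := mul_nonneg (mul_nonneg (by linarith) hlA0.le) hlB0.le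
  -- the cap is nonnegative at any point of the polytope
  have hcap0 : 0 ≤ WP - C := by
    have h1 : 0 ≤ qB * PA := mul_nonneg hqB hPA0
    have h2 : 0 ≤ qA * PB := mul_nonneg hqA hPB0
    linarith
  -- affine coefficients
  set α := qB - nB * X with hα
  set β' := qA - nA * Y with hβ'
  suffices hG : 0 ≤ α * PA + β' * PB + C by
    have : nB * PA * X + nA * PB * Y = qB * PA + qA * PB + C - (α * PA + β' * PB + C) := by
      simp only [hα, hβ']; ring
    linarith
  have hαl : -lB ≤ α := by
    have : nB * X ≤ nB := mul_le_of_le_one_right hnB hX1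
    simp only [hα] at this ⊢; linarith
  have hβl : -lA ≤ β' := by
    have : nA * Y ≤ nA := mul_le_of_le_one_right hnA hY1
    simp only [hβ'] at this ⊢; linarith
  by_cases ha : 0 ≤ α
  · by_cases hb : 0 ≤ β'
    · have h4 : 0 ≤ α * PA := mul_nonneg ha hPA0
      have h5 : 0 ≤ β' * PB := mul_nonneg hb hPB0
      linarith
    · push Not at hb
      have h1 : β' * UB ≤ β' * PB := mul_le_mul_of_nonpos_left hPB1 hb.le
      have h3 : -lA * UB ≤ β' * UB := by
        have hUB0 : 0 ≤ UB := hPB0.trans hPB1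
        exact mul_le_mul_of_nonneg_right hβl hUB0
      have h4 : 0 ≤ α * PA := mul_nonneg ha hPA0
      have h6 : lA * UB ≤ lA * ((1 + ε) * lB) := mul_le_mul_of_nonneg_left hUB1 hlA0.le
      have e : lA * ((1 + ε) * lB) = C := by simp only [hCdef]; ring
      linarith
  · push Not at ha
    by_cases hb : 0 ≤ β'
    · have h1 : α * UA ≤ α * PA := mul_le_mul_of_nonpos_left hPA1 ha.le
      have h3 : -lB * UA ≤ α * UA := by
        have hUA0 : 0 ≤ UA := hPA0.trans hPA1
        exact mul_le_mul_of_nonneg_right hαl hUA0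
      have h4 : 0 ≤ β' * PB := mul_nonneg hb hPB0
      have h6 : lB * UA ≤ lB * ((1 + ε) * lA) := mul_le_mul_of_nonneg_left hUA1 hlB0.le
      have e : lB * ((1 + ε) * lA) = C := by simp only [hCdef]; ring
      linarith
    · push Not at hb
      -- both coefficients negative
      by_cases hcf : qB * UA + qA * UB ≤ WP - C
      · -- the corner is feasible: G ≥ G(corner) ≥ 0
        have h1 : α * UA ≤ α * PA := mul_le_mul_of_nonpos_left hPA1 ha.le
        have h2 : β' * UB ≤ β' * PB := mul_le_mul_of_nonpos_left hPB1 hb.le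
        have hc := hC lA lB x hlA0 hlA1 hlB0 hlB1 hx0 hx1 hcf
        have e : α * UA + β' * UB + C = qB * UA + qA * UB + C - (nB * UA * X + nA * UB * Y) := by
          simp only [hα, hβ']; ring
        linarith
      · push Not at hcf
        -- vertex facts F1 (at P1) and F2 (at P2, by symmetry)
        have hp1 := hP1 lA lB x hlA0 hlA1 hlB0 hlB1 hx0 hx1 hcap0 hcf
        have hsymP : lB + lA - (2 * β - 1) * lB * lA = lA + lB - (2 * β - 1) * lA * lB := by ring
        have hsymC : (1 + ε) * lB * lA = C := by simp only [hCdef]; ring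
        have hcf' : W (lB + lA - (2 * β - 1) * lB * lA) - (1 + ε) * lB * lA <
            (1 - β * lA) * U lB + (1 - β * lB) * U lA := by
          rw [hsymP, hsymC]; linarith
        have hcap0' : 0 ≤ W (lB + lA - (2 * β - 1) * lB * lA) - (1 + ε) * lB * lA := by
          rw [hsymP, hsymC]; exact hcap0
        have hp2 := hP1 lB lA (1 - x) hlB0 hlB1 hlA0 hlA1 (by linarith) (by linarith) hcap0' hcf'
        have h1x : 1 - (1 - x) = x := by ring
        rw [hsymP, hsymC, h1x] at hp2
        have F1 : 0 ≤ qA * (α * UA) + β' * (WP - C - qB * UA) + qA * C := by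
          have e : qA * (α * UA) + β' * (WP - C - qB * UA) + qA * C =
              qA * WP - (qA * nB * UA * X + nA * (WP - C - qB * UA) * Y) := by
            simp only [hα, hβ']; ring
          rw [e]
          have : qA * nB * UA * X + nA * (WP - C - qB * UA) * Y ≤ qA * WP := by
            have := hp1; simp only [hqAdef, hnBdef, hnAdef, hqBdef, hUA, hWP, hCdef, hX, hY] at this ⊢
            linarith
          linarith
        have F2 : 0 ≤ qB * (β' * UB) + α * (WP - C - qA * UB) + qB * C := by
          have e : qB * (β' * UB) + α * (WP - C - qA * UB) + qB * C =
              qB * WP - (qB * nA * UB * Y + nB * (WP - C - qA * UB) * X) := by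
            simp only [hα, hβ']; ring
          rw [e]
          have : qB * nA * UB * Y + nB * (WP - C - qA * UB) * X ≤ qB * WP := by
            have := hp2; simp only [hqAdef, hnBdef, hnAdef, hqBdef, hUB, hWP, hCdef, hX, hY] at this ⊢
            linarith
          linarith
        set σ := qA * α - qB * β' with hσ
        by_cases hs : σ ≤ 0
        · -- use P1; need qA > 0
          have hqApos : 0 < qA := by
            rcases lt_or_eq_of_le hqA with h | h
            · exact h
            · exfalso
              -- qA = 0 ⟹ σ = −qB β' ≥ 0 ⟹ qB β' = 0 ⟹ qB = 0 ⟹ cap < 0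
              have hqA0 : qA = 0 := by rw [hqAdef]; linarith
              have hs0 : qB * β' = 0 := by
                have : σ = -(qB * β') := by rw [hσ, hqA0]; ring
                have h2 : qB * β' ≤ 0 := mul_nonpos_of_nonneg_of_nonpos hqB hb.le
                linarith
              have hqB0 : qB = 0 := by
                rcases mul_eq_zero.1 hs0 with h | h
                · exact h
                · exfalso; linarith
              have : WP - C < 0 := by
                have := hcf; rw [hqA0, hqB0] at this; linarith
              linarith
          have hd : qA * PB - (WP - C - qB * UA) ≤ qB * (UA - PA) := by linarith
          have hstep : β' * (qB * (UA - PA)) ≤ β' * (qA * PB - (WP - C - qB * UA)) :=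
            mul_le_mul_of_nonpos_left hd hb.le
          have e : qA * (α * PA + β' * PB + C) =
              (qA * (α * UA) + β' * (WP - C - qB * UA) + qA * C)
              + qA * α * (PA - UA) + β' * (qA * PB - (WP - C - qB * UA)) := by ring
          have hid : qA * α * (PA - UA) + β' * (qB * (UA - PA)) = (UA - PA) * (-σ) := by
            simp only [hσ]; ring
          have hpos : 0 ≤ (UA - PA) * (-σ) := mul_nonneg (by linarith) (by linarith)
          have hkey : 0 ≤ qA * (α * PA + β' * PB + C) := by rw [e]; linarith
          by_contra hneg
          push Not at hneg
          have : qA * (α * PA + β' * PB + C) < 0 := mul_neg_of_pos_of_neg hqApos hneg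
          linarith
        · push Not at hs
          have hqBpos : 0 < qB := by
            rcases lt_or_eq_of_le hqB with h | h
            · exact h
            · exfalso
              have hqB0 : qB = 0 := by rw [hqBdef]; linarith
              have : σ = qA * α := by rw [hσ, hqB0]; ring
              have h2 : qA * α ≤ 0 := mul_nonpos_of_nonneg_of_nonpos hqA ha.le
              linarith
          have hd : qB * PA - (WP - C - qA * UB) ≤ qA * (UB - PB) := by linarith
          have hstep : α * (qA * (UB - PB)) ≤ α * (qB * PA - (WP - C - qA * UB)) :=
            mul_le_mul_of_nonpos_left hd ha.le
          have e : qB * (α * PA + β' * PB + C) =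
              (qB * (β' * UB) + α * (WP - C - qA * UB) + qB * C)
              + qB * β' * (PB - UB) + α * (qB * PA - (WP - C - qA * UB)) := by ring
          have hid : qB * β' * (PB - UB) + α * (qA * (UB - PB)) = (UB - PB) * σ := by
            simp only [hσ]; ring
          have hpos : 0 ≤ (UB - PB) * σ := mul_nonneg (by linarith) hs.le
          have hkey : 0 ≤ qB * (α * PA + β' * PB + C) := by rw [e]; linarith
          by_contra hneg
          push Not at hneg
          have : qB * (α * PA + β' * PB + C) < 0 := mul_neg_of_pos_of_neg hqBpos hneg
          linarith

end Summit.MatrixMultiplication.MatrixMultiplication.Theorems.FarEdgeDescentTreeCapEnvTools
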